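import Literature.NumberTheory.IwasawaTheory.ClassicalMuInvariant
import Literature.NumberTheory.EllipticCurves.ZpExtensionUnramifiedProofs
import Literature.NumberTheory.EllipticCurves.IwasawaTowerTorsionOrdinaryProofs
import HarnessLib

/-!
# Fukuda's index is `n₀ = 0` for the cyclotomic `ℤ_p`-extension of `ℚ` (non-vacuity of `TotallyRamifiedFrom`)

Topic `NumberTheory/IwasawaTheory` (namespace = path).  A PROVED anchor for the definition
`Literature.NumberTheory.IwasawaTheory.TotallyRamifiedFrom` (Fukuda 1994's standing index `n₀`, §5 of
`Literature/NumberTheory/IwasawaTheory/ClassicalMuInvariant.lean`, work-item `wi-78929`): for the cyclotomic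
`ℤ_p`-extension `ℚ_∞/ℚ` every prime is either unramified or totally ramified from the bottom layer, i.e.
`TotallyRamifiedFrom κ 0` (hence `TotallyRamifiedFrom κ n₀` for every `n₀`).  Kept in its own file so that
`ClassicalMuInvariant.lean` (statements) does not import the two proof files used here.

Proof = two tree theorems: a prime `w ∤ p` of `ℚ` is unramified in any `ℤ_p`-extension
(`Literature.NumberTheory.EllipticCurves.ZpExtension.inertia_le_kerSubgroup_holds`, Washington Prop. 13.2:
`I_𝔓 ≤ ker κ`), and `p` is totally ramified in `ℚ_∞/ℚ`
(`Literature.NumberTheory.EllipticCurves.ZpExtension.IsCyclotomic.inertia_sup_kerSubgroup_eq_top`,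
Washington §13.1: `I_𝔓 ⊔ ker κ = ⊤`); the bridge «`(p) ⊆ w` iff `w` corresponds to `p` under Mathlib's
`Rat.HeightOneSpectrum.primesEquiv`» is `Rat.HeightOneSpectrum.natGenerator_dvd_iff`.

## References

* [Fukuda1994] T. Fukuda, *Remarks on `ℤ_p`-extensions of number fields*, Proc. Japan Acad. Ser. A 70 (1994),
  p. 264 (the index `n₀`).
* [Washington1997] L. Washington, *Introduction to Cyclotomic Fields*, §13.1 and Prop. 13.2 (as cited by the
  two tree theorems used; not re-read here).
-/

noncomputable section

open scoped NumberField
open Literature.NumberTheory.EllipticCurves Literature.NumberTheory.GaloisRepresentations Field IsDedekindDomain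
  Rat.HeightOneSpectrum

namespace Literature.NumberTheory.IwasawaTheory

variable {p : ℕ} [Fact p.Prime]

/-- A finite place `w` of `ℚ` containing the rational prime `p` IS the place `p` under Mathlib's
`Rat.HeightOneSpectrum.primesEquiv` (`natGenerator w ∣ p`, both prime; cf. the `↔ natGenerator v ∣ p` form
`Literature.NumberTheory.DiophantineGeometry.UniformABCConjecture.natCast_mem_asIdeal_iff`, not imported here to
keep this file's cone inside `NumberTheory/EllipticCurves` + `IwasawaTheory`). [folklore] -/
private theorem primesEquiv_eq_of_natCast_mem {w : HeightOneSpectrum (𝓞 ℚ)} (hw : ((p : ℕ) : 𝓞 ℚ) ∈ w.asIdeal) :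
    (primesEquiv w : ℕ) = p := by
  have h1 : natGenerator w ∣ p := by
    rw [natGenerator_dvd_iff, ← map_natCast (Rat.IsIntegralClosure.intEquiv (𝓞 ℚ)) p,
      Ideal.apply_mem_of_equiv_iff]
    exact hw
  exact (Nat.prime_dvd_prime_iff_eq (prime_natGenerator w) Fact.out).mp h1

/-- **Fukuda's index is `n₀ = 0` for `ℚ_∞/ℚ`**: for the cyclotomic `ℤ_p`-extension `κ` of `ℚ`, every prime `𝔓`
of `\bar ℤ` above a finite place `w` of `ℚ` has `I_𝔓 ≤ ker κ` (`w ∤ p`: unramified, Washington Prop. 13.2, tree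
theorem `ZpExtension.inertia_le_kerSubgroup_holds`) or `I_𝔓 ⊔ ker κ = Γ_ℚ` (`w ∣ p`: totally ramified,
Washington §13.1, tree theorem `ZpExtension.IsCyclotomic.inertia_sup_kerSubgroup_eq_top`) — the non-vacuity
of `TotallyRamifiedFrom` at `n₀ = 0`. [cite: Fukuda1994, p. 264 (the index `n₀`)]
[cite: Washington1997, §13.1 and Prop. 13.2] -/
theorem totallyRamifiedFrom_zero_of_isCyclotomic_rat {κ : ZpExtension ℚ p} (hκ : κ.IsCyclotomic) :
    TotallyRamifiedFrom κ 0 := by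
  rw [totallyRamifiedFrom_zero_iff]
  intro w 𝔓 h𝔓
  by_cases hw : ((p : ℕ) : 𝓞 ℚ) ∈ w.asIdeal
  · exact Or.inr (hκ.inertia_sup_kerSubgroup_eq_top (primesEquiv_eq_of_natCast_mem hw) h𝔓)
  · exact Or.inl (ZpExtension.inertia_le_kerSubgroup_holds ℚ p κ hw h𝔓)

/-- Hence the cyclotomic `ℤ_p`-extension of `ℚ` satisfies Fukuda's hypothesis `TotallyRamifiedFrom κ n₀` for
EVERY index `n₀` (`TotallyRamifiedFrom.mono`). [cite: Fukuda1994, p. 264 (the index `n₀`)] -/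
theorem totallyRamifiedFrom_of_isCyclotomic_rat {κ : ZpExtension ℚ p} (hκ : κ.IsCyclotomic) (n₀ : ℕ) :
    TotallyRamifiedFrom κ n₀ :=
  (totallyRamifiedFrom_zero_of_isCyclotomic_rat hκ).mono (Nat.zero_le n₀)

end Literature.NumberTheory.IwasawaTheory

end
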